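import Summits.QuantumFields.YangMills.Theorems.BalabanUVNodesN21AtSpineCarriersSanity
import Summits.QuantumFields.YangMills.Theorems.BalabanUVNodesN20AtRecord11
import Literature.MathematicalPhysics.QuantumFieldTheory.Balaban1983to89.Node00.Record11

/-!
# YM-DAG node N21 (= NE7c) AT NODE 00's STAGE-11 RECORD `Node00.IsRecordOfRecord₁₁C` (`Node00/Record11.lean`, p444286): the K5 stub
# `YMDAG.UVSplit.S_N21 SRec` for spine-carrier predicates TYPED OVER THE ₁₁ RECORD — the ₁₁ successor of `BalabanUVNodesN21AtSpineCarriers` (p417321),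
# shape twin of `BalabanUVNodesN20AtRecord11` (p450743)

Track A of `YM-PLAN.md` (cell `pub-ymgap`, HUMAN RULING D-0062), node **N21**; R134 fan-out seat `pub-ymgap-dag-n21-d` (strategy s2 = BY-NAME KNIT at
the ₁₁ record; dag-lead FAN-OUT v1.1 §N21 s2 «`S_N21 SRec` at the rate-record home ∕ ₁₁, one application per reading predicate»; dag-lead WORDS-99:
«keep the parametric binder until `SRec₁₁` lands», the (T-SPINE) home `BalabanUVNodesSpineCarriersOfRecord11` being dag-n20-e's).  Kernel bookkeeping
BY NAME: 0 `def`, 0 `sorry`, standard axioms.  COUNT-NEUTRAL; `--supports` the K3 item `SpineGivenEndpointR11` (stmt-QuantumFields-19676) of route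
`BalabanUVNodes` rev 6, which quantifies over `Node00.IsRecordOfRecord₁₁C F 2 D w`.  Restate-immune (neither the Theses file nor any ∃-currency module
imported).

THE POINT.  `S_N21 SRec := ∀ F D g₀ os S, SRec F D g₀ os S → T4IndicatorShell.ShellWeightBound S.l₀ S.T S.A S.B S.shA S.shB S.Wsh` reads the record ONLY
through the SET OF BUNDLES `SRec` pins (§1 `s_N21_iff_forall_pinned`: N21 is DATUM-BLIND exactly as N20 is — `ShellWeightBound` mentions no field of
`D`).  At Stage 11 a record pair is `(D, w)` with `D = Node00.datumOfRecord₁₁ F N θ hP` for an ADMISSIBLE `θ : Node00.Stage11Params F N` WITH ITS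
DISPLAYED PROVISOS; a predicate KEYED at ₁₁ by a reading `cr : (F, θ, hP, g₀, os) ↦ SpineCarriers` pins exactly the bundles `cr F θ hP g₀ os` at
`datumOfRecord₁₁ F N θ hP` (dag-lead WORDS-99's functional key; dag-n20-e (S2)).  NO home of the spine carriers exists today: `cr` is a PARAMETER of every
statement below; when (T-SPINE) lands `SRec₁₁`, instantiation is a substitution and its `S_N21` instance is `s_N21_of_keyed₁₁` + one §2 closer.

WHAT THIS MODULE PROVES.
* §1 READINGS: `s_N21_iff_forall_pinned` · `s_N21_of_image` (IMAGE-antitone re-key; contains p417321's `N21AtSpineCarriers.s_N21_mono`) ·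
  **`s_N21_keyed₁₁_iff`** (at a predicate keyed at ₁₁ by `cr`, `S_N21` ⟺ «NE7c's `ShellWeightBound` at `cr F θ hP g₀ os` for EVERY family, EVERY
  admissible Stage-11 θ with provisos, every `g₀`, `os`») · `s_N21_of_keyed₁₁` (one-sided key) · `s_N21_of_stage11_slot`.
* §2 CLOSERS RE-KEYED OVER θ, BY NAME — p417321's three readings with `S := cr F θ hP g₀ os`: `s_N21_keyed₁₁_of_slotLedgers` (road-agnostic: two
  `T4ShellMeasure.SlotLedger`s under one geometric majorant), `s_N21_keyed₁₁_of_levels` (road I: two `LevelLedger`s + live windows + `D ≤ D̄` + width rate —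
  dag-n21-a's `n21_knit_levels`), `s_N21_keyed₁₁_of_ages` (road II: two `AgeLedger`s + a `LevelGain` — `n21_knit_ages_slot`).  The measure-level readings of
  p419827 (`s_N21_of_slotACReading` ∕ `_of_realizedReading` ∕ `_of_levelDataSU2Reading`) re-key the same way through `s_N21_of_keyed₁₁`.
* §3 WHERE THE ₁₁ OBJECTS ENTER N21: (a) NE7c AS THE ₁₁ SENTENCE — under the dictionary E1 ∕ E2 at the ₁₁ datum (the `S_N27x` clause) the SHELL PARTS carry
  at most `S.Wsh K` of the string's dressed partition function of record after `S.K₀ + K` ∕ `S.K₀ + K + 1` steps (`shellWeight_le_schemeZ_datumOfRecord₁₁_left ∕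
  _right`; positivity of those partition functions is dag-n20-e's `N20AtRecord11.schemeZ_pos_datumOfRecord₁₁`, hypothesis-free at ₁₁); (b) the SLOT TEST OF
  RECORD — what the reading's shells `(cr …).shA ∕ .shB` are carved from — is `Node00.chiOfRecord F N θ.ν …` ([III] (2.17): a finite product of cube slot
  indicators at the coupling-dependent threshold `ε(g_k)η²`), whose two-run mismatch this seat's companion module
  `BalabanUVNodesN21SlotTestAtRecord` (p452009) covers slot by slot by single-run bands.
* §4 NON-VACUITY ⟺ K0's BODY AT `N`: `s_N21_keyed₁₁_of_uninhabited` (if NO admissible Stage-11 θ satisfies its provisos, a predicate typed over ₁₁C pins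
  nothing and `S_N21` is FREE); conversely dag-n20-e's `N20AtRecord11.exists_pinned_keyed₁₁_of_inhabited` (stub-agnostic, cited not restated): under K0's
  body a keyed predicate pins a bundle at a ₁₁ datum on every family; `shellWeightBound_keyed₁₁_of_isRecordOfRecord₁₁C` (the consumer face AT A ₁₁ RECORD
  PAIR: what the ₁₁ join of N27 consumes next to `S_N27x`, `S_N20`, `S_N19`).
* §5 SHADOW: `s_N21_keyed₁₁_iff_shadow₅` — the same reading keyed to def-T's ₅C shadow datum gives THE SAME `S_N21` (datum-blindness; twin of
  `N20AtRecord11.s_N20_keyed₁₁_iff_shadow₅`).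
* §6 THE A2 TRAP PERSISTS AT ₁₁: `s_N21_keyed₁₁_of_zeroShell` — a reading `cr` with ZERO shells and zero slot has `S_N21` at ₁₁ with no estimate
  (p419285's `s_N21_of_zeroShellReading` re-keyed); READING FOR THE (T-SPINE) AUTHOR: `(cr …).shA ∕ .shB` must be pinned ONCE as the parts of the terms on
  which the two runs' products of the record's slot indicators `Node00.chiOfRecord` DISAGREE — the SAME parts `S_N19`'s cores exclude (`N21-PIN-LIST.md` §0).

HONEST FRAMING.  NE7c is NOT PRINTED and NOT PROVED; no inhabitant of `IsRecordOfRecord₁₁C` is claimed (K0 open); no reading `cr` of Bałaban's two-run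
class expansion off θ exists in the tree (NODE O ∕ the (T-SPINE) home); every ledger, window, rate and weight below is a HYPOTHESIS on the reading;
nothing of Bałaban's is asserted or instantiated; N21 is NOT discharged (0∕1 at every record); typed 28∕28, discharged count untouched; one finite
four-torus programme at fixed `ε` — NOT ℝ⁴, NOT infinite volume, NOT OS, NOT a mass gap, NOT Clay.  No decl below carries a cite tag.
-/

open Finset

namespace Summit.QuantumFields.YangMills.Theorems.N21AtRecord11

open Literature.MathematicalPhysics.QuantumFieldTheory.Balaban1983to89
open Literature.MathematicalPhysics.QuantumFieldTheory.Balaban1983to89.T4Continuum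
open T4IndicatorShell (ShellWeightBound)
open T4ShellMeasure (SlotLedger)
open T4ShellMeasureLevels (LevelLedger LiveWindow)
open T4ShellCount (AgeLedger LevelGain)
open Summit.QuantumFields.YangMills.Theorems.N21AtSpineCarriers (s_N21_of_slotLedgersReading s_N21_of_levelsReading s_N21_of_agesReading
  s_N21_of_zeroShellReading)
open YMDAG.UVSplit (Datum SpineCarriers SpineRecordPred S_N21)
open Node00 (Stage11Params datumOfRecord₁₁ IsRecordOfRecord₁₁C)

variable {N : ℕ} [NeZero N]

/-! ## §1 Readings: N21 is datum-blind; the image re-key; `S_N21` at a predicate KEYED at the ₁₁ record -/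

/-- **N21 IS DATUM-BLIND.**  `S_N21 SRec` holds iff NE7c's `ShellWeightBound` holds at EVERY bundle that `SRec` pins somewhere — the datum `D`, the bare
sequence `g₀` and the string `os` enter only through WHICH bundles are pinned. [bookkeeping] -/
theorem s_N21_iff_forall_pinned (SRec : SpineRecordPred N) :
    S_N21 SRec ↔ ∀ S : SpineCarriers,
      (∃ (F : T4Family) (D : Datum F N) (g₀ : ℕ → ℝ) (os : List (ULoop F)), SRec F D g₀ os S) →
        ShellWeightBound S.l₀ S.T S.A S.B S.shA S.shB S.Wsh :=
  ⟨fun h S ⟨F, D, g₀, os, hS⟩ => h F D g₀ os S hS, fun h F D g₀ os S hS => h S ⟨F, D, g₀, os, hS⟩⟩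

/-- **THE IMAGE RE-KEY (antitone in the set of pinned bundles).**  If every bundle `SRec'` pins somewhere is pinned somewhere by `SRec`, then
`S_N21 SRec → S_N21 SRec'` (contains p417321's pointwise `s_N21_mono`; moves a reading between a ₁₁ datum and its ₅C shadow at no cost, §5). [bookkeeping] -/
theorem s_N21_of_image {SRec SRec' : SpineRecordPred N}
    (himg : ∀ S : SpineCarriers,
      (∃ (F : T4Family) (D : Datum F N) (g₀ : ℕ → ℝ) (os : List (ULoop F)), SRec' F D g₀ os S) →
        ∃ (F : T4Family) (D : Datum F N) (g₀ : ℕ → ℝ) (os : List (ULoop F)), SRec F D g₀ os S)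
    (h : S_N21 SRec) : S_N21 SRec' := by
  rw [s_N21_iff_forall_pinned] at h ⊢
  exact fun S hS => h S (himg S hS)

section Keyed

-- `cr`: a READING of spine carriers off NODE 00's Stage-11 parameter tuples with provisos (a PARAMETER: no such reading of Bałaban's two-run class
-- expansion exists in the tree; the (T-SPINE) home `SRec₁₁` will supply one).
variable (cr : (F : T4Family) → (θ : Stage11Params F N) → θ.Provisos₁₁ → (ℕ → ℝ) → List (ULoop F) → SpineCarriers)

/-- **THE RE-KEY AT ₁₁.**  Let `SRec` be KEYED at the Stage-11 record by `cr`: it pins, at `(F, D, g₀, os)`, exactly the bundles `cr F θ hP g₀ os` of the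
ADMISSIBLE Stage-11 parameter tuples `θ` WITH PROVISOS `hP` whose datum of record IS `D`.  Then `S_N21 SRec` is EXACTLY «for every family, every
admissible Stage-11 `θ` with provisos, every `g₀` and `os`, NE7c's `ShellWeightBound` holds at the carriers `cr F θ hP g₀ os`». [bookkeeping] -/
theorem s_N21_keyed₁₁_iff (SRec : SpineRecordPred N)
    (hkey : ∀ (F : T4Family) (D : Datum F N) (g₀ : ℕ → ℝ) (os : List (ULoop F)) (S : SpineCarriers), SRec F D g₀ os S ↔
      ∃ (θ : Stage11Params F N) (hP : θ.Provisos₁₁), θ.Admissible ∧ D = datumOfRecord₁₁ F N θ hP ∧ S = cr F θ hP g₀ os) :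
    S_N21 SRec ↔ ∀ (F : T4Family) (θ : Stage11Params F N) (hP : θ.Provisos₁₁), θ.Admissible → ∀ (g₀ : ℕ → ℝ) (os : List (ULoop F)),
      ShellWeightBound (cr F θ hP g₀ os).l₀ (cr F θ hP g₀ os).T (cr F θ hP g₀ os).A (cr F θ hP g₀ os).B (cr F θ hP g₀ os).shA
        (cr F θ hP g₀ os).shB (cr F θ hP g₀ os).Wsh := by
  constructor
  · intro h F θ hP hθ g₀ os
    exact h F (datumOfRecord₁₁ F N θ hP) g₀ os (cr F θ hP g₀ os) ((hkey F _ g₀ os _).mpr ⟨θ, hP, hθ, rfl, rfl⟩)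
  · intro h F D g₀ os S hS
    obtain ⟨θ, hP, hθ, -, rfl⟩ := (hkey F D g₀ os S).mp hS
    exact h F θ hP hθ g₀ os

/-- **ONE-SIDED KEY suffices for the closer direction**: if every pinned bundle IS the reading of some admissible Stage-11 θ with provisos realising the
datum, NE7c at every reading gives `S_N21 SRec`. [bookkeeping] -/
theorem s_N21_of_keyed₁₁ (SRec : SpineRecordPred N)
    (hkey : ∀ (F : T4Family) (D : Datum F N) (g₀ : ℕ → ℝ) (os : List (ULoop F)) (S : SpineCarriers), SRec F D g₀ os S →
      ∃ (θ : Stage11Params F N) (hP : θ.Provisos₁₁), θ.Admissible ∧ D = datumOfRecord₁₁ F N θ hP ∧ S = cr F θ hP g₀ os)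
    (h : ∀ (F : T4Family) (θ : Stage11Params F N) (hP : θ.Provisos₁₁), θ.Admissible → ∀ (g₀ : ℕ → ℝ) (os : List (ULoop F)),
      ShellWeightBound (cr F θ hP g₀ os).l₀ (cr F θ hP g₀ os).T (cr F θ hP g₀ os).A (cr F θ hP g₀ os).B (cr F θ hP g₀ os).shA
        (cr F θ hP g₀ os).shB (cr F θ hP g₀ os).Wsh) :
    S_N21 SRec := by
  intro F D g₀ os S hS
  obtain ⟨θ, hP, hθ, -, rfl⟩ := hkey F D g₀ os S hS
  exact h F θ hP hθ g₀ os

end Keyed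

/-- **(W2) CLOSER — `S_N21 SRec` FOR EVERY SPINE-CARRIER PREDICATE TYPED OVER THE STAGE-11 RECORD WITH THE BOUND**: if every bundle of record comes with
an admissible Stage-11 witness θ WITH ITS PROVISOS realising `D` and NE7c's `ShellWeightBound` at its own carriers, then `S_N21 SRec`.  The θ-witness is
DISPLAYED, not used (datum-blindness) — the ₁₁ objects enter N21 only through a READING of the carriers (§2), the dictionary (§3a) or the slot test of
record (§3b). [bookkeeping] -/
theorem s_N21_of_stage11_slot (SRec : SpineRecordPred N)
    (hslot : ∀ (F : T4Family) (D : Datum F N) (g₀ : ℕ → ℝ) (os : List (ULoop F)) (S : SpineCarriers), SRec F D g₀ os S →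
      ∃ (θ : Stage11Params F N) (hP : θ.Provisos₁₁), θ.Admissible ∧ D = datumOfRecord₁₁ F N θ hP ∧
        ShellWeightBound S.l₀ S.T S.A S.B S.shA S.shB S.Wsh) :
    S_N21 SRec := by
  intro F D g₀ os S hS
  obtain ⟨θ, hP, -, -, h⟩ := hslot F D g₀ os S hS
  exact h

/-! ## §2 The readings of p417321 RE-KEYED over NODE 00's Stage-11 parameter tuples (dag-n21-a's knits BY NAME) -/

section Closers

variable (cr : (F : T4Family) → (θ : Stage11Params F N) → θ.Provisos₁₁ → (ℕ → ℝ) → List (ULoop F) → SpineCarriers)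

/-- **`S_N21` AT ₁₁ FROM TWO SLOT LEDGERS UNDER ONE GEOMETRIC MAJORANT (road-agnostic).**  At a predicate keyed at ₁₁ by `cr` (one-sided key): if for every
admissible Stage-11 θ with provisos and every `(g₀, os)` the reading `S := cr F θ hP g₀ os` carries two `T4ShellMeasure.SlotLedger`s at `(S.l₀, S.T, S.A,
S.shA)` ∕ `(…, S.B, S.shB)` whose relative shell weights lie under `C·ϑ^K`, `0 ≤ ϑ < 1`, with `S.Wsh` summable and dominating their sum — then `S_N21 SRec`
(p417321 `s_N21_of_slotLedgersReading` BY NAME at θ's reading; road I's level ledgers and road (δ)'s realized ledgers are both instances). [bookkeeping] -/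
theorem s_N21_keyed₁₁_of_slotLedgers (SRec : SpineRecordPred N)
    (hkey : ∀ (F : T4Family) (D : Datum F N) (g₀ : ℕ → ℝ) (os : List (ULoop F)) (S : SpineCarriers), SRec F D g₀ os S →
      ∃ (θ : Stage11Params F N) (hP : θ.Provisos₁₁), θ.Admissible ∧ D = datumOfRecord₁₁ F N θ hP ∧ S = cr F θ hP g₀ os)
    (hrows : ∀ (F : T4Family) (θ : Stage11Params F N) (hP : θ.Provisos₁₁), θ.Admissible → ∀ (g₀ : ℕ → ℝ) (os : List (ULoop F)),
      ∃ (σA σB : Type) (SA : ℕ → Finset σA) (SB : ℕ → Finset σB) (pieceA : ℕ → ℝ → σA → (cr F θ hP g₀ os).ι → ℝ)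
        (pieceB : ℕ → ℝ → σB → (cr F θ hP g₀ os).ι → ℝ) (cA : ℕ → σA → ℝ) (cB : ℕ → σB → ℝ) (C ϑ : ℝ),
        SlotLedger (cr F θ hP g₀ os).l₀ (cr F θ hP g₀ os).T (cr F θ hP g₀ os).A (cr F θ hP g₀ os).shA SA pieceA cA ∧
        SlotLedger (cr F θ hP g₀ os).l₀ (cr F θ hP g₀ os).T (cr F θ hP g₀ os).B (cr F θ hP g₀ os).shB SB pieceB cB ∧
        0 ≤ ϑ ∧ ϑ < 1 ∧ (∀ K, ∑ s ∈ SA K, cA K s ≤ C * ϑ ^ K) ∧ (∀ K, ∑ s ∈ SB K, cB K s ≤ C * ϑ ^ K) ∧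
        (∀ K, ∑ s ∈ SA K, cA K s + ∑ s ∈ SB K, cB K s ≤ (cr F θ hP g₀ os).Wsh K) ∧ Summable (cr F θ hP g₀ os).Wsh) :
    S_N21 SRec :=
  s_N21_of_slotLedgersReading SRec fun F D g₀ os S hS => by
    obtain ⟨θ, hP, hθ, -, rfl⟩ := hkey F D g₀ os S hS
    exact hrows F θ hP hθ g₀ os

/-- **`S_N21` AT ₁₁ ON ROAD I (level ledgers).**  At a predicate keyed at ₁₁ by `cr`: if for every admissible Stage-11 θ with provisos and every `(g₀, os)`
the reading carries road I's package — two `T4ShellMeasureLevels.LevelLedger`s ([dict] + (M1) `SlotAntiConcentration` per live slot by level), two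
`LiveWindow`s (N20), `D ≤ D̄` (N12), a rate `0 < ϑ < 1`, `ρ ≤ c₁ϑ^j` (N16 — produced at the family's block size by dag-n21-a's files 3∕6 as `(C_Q∕ε)θ^k`),
and `(cr …).Wsh` summable `≥ 2((N₁+1)ν̄D̄c₁ϑ^{−N₁})ϑ^K` — then `S_N21 SRec` (`n21_knit_levels` BY NAME through p417321 `s_N21_of_levelsReading`).
[bookkeeping] -/
theorem s_N21_keyed₁₁_of_levels (SRec : SpineRecordPred N)
    (hkey : ∀ (F : T4Family) (D : Datum F N) (g₀ : ℕ → ℝ) (os : List (ULoop F)) (S : SpineCarriers), SRec F D g₀ os S →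
      ∃ (θ : Stage11Params F N) (hP : θ.Provisos₁₁), θ.Admissible ∧ D = datumOfRecord₁₁ F N θ hP ∧ S = cr F θ hP g₀ os)
    (hrows : ∀ (F : T4Family) (θ : Stage11Params F N) (hP : θ.Provisos₁₁), θ.Admissible → ∀ (g₀ : ℕ → ℝ) (os : List (ULoop F)),
      ∃ (σA σB : Type) (SA : ℕ → Finset σA) (SB : ℕ → Finset σB) (pieceA : ℕ → ℝ → σA → (cr F θ hP g₀ os).ι → ℝ)
        (pieceB : ℕ → ℝ → σB → (cr F θ hP g₀ os).ι → ℝ) (lvlA : ℕ → σA → ℕ) (lvlB : ℕ → σB → ℕ) (DA ρA DB ρB : ℕ → ℝ)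
        (N₁ : ℕ) (νbar Dbar c₁ ϑ : ℝ),
        LevelLedger (cr F θ hP g₀ os).l₀ (cr F θ hP g₀ os).T (cr F θ hP g₀ os).A (cr F θ hP g₀ os).shA SA pieceA lvlA DA ρA ∧
        LevelLedger (cr F θ hP g₀ os).l₀ (cr F θ hP g₀ os).T (cr F θ hP g₀ os).B (cr F θ hP g₀ os).shB SB pieceB lvlB DB ρB ∧
        LiveWindow SA lvlA N₁ νbar ∧ LiveWindow SB lvlB N₁ νbar ∧ (∀ j, DA j ≤ Dbar) ∧ (∀ j, DB j ≤ Dbar) ∧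
        0 < ϑ ∧ ϑ < 1 ∧ (∀ j, ρA j ≤ c₁ * ϑ ^ j) ∧ (∀ j, ρB j ≤ c₁ * ϑ ^ j) ∧
        (∀ K, (2 * ((N₁ + 1) * νbar * Dbar * c₁ * ϑ⁻¹ ^ N₁)) * ϑ ^ K ≤ (cr F θ hP g₀ os).Wsh K) ∧ Summable (cr F θ hP g₀ os).Wsh) :
    S_N21 SRec :=
  s_N21_of_levelsReading SRec fun F D g₀ os S hS => by
    obtain ⟨θ, hP, hθ, -, rfl⟩ := hkey F D g₀ os S hS
    exact hrows F θ hP hθ g₀ os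

/-- **`S_N21` AT ₁₁ ON ROAD II (age ledgers with a level gain).**  At a predicate keyed at ₁₁ by `cr`: if at every admissible Stage-11 θ with provisos the
reading carries road II's package — a window `Nw`, slot counts `n`, slot shell pieces, per-age ratios `x`, two `T4ShellCount.AgeLedger`s, the shell parts
`0 ≤ sh ≤` weight covered by the slot pieces, a `LevelGain Nw x p y`, and `(cr …).Wsh` summable `≥ Σ_{a≤Nw} n_a e^{−pa} y(K − a)` — then `S_N21 SRec`
(`n21_knit_ages_slot` BY NAME through p417321 `s_N21_of_agesReading`). [bookkeeping] -/
theorem s_N21_keyed₁₁_of_ages (SRec : SpineRecordPred N)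
    (hkey : ∀ (F : T4Family) (D : Datum F N) (g₀ : ℕ → ℝ) (os : List (ULoop F)) (S : SpineCarriers), SRec F D g₀ os S →
      ∃ (θ : Stage11Params F N) (hP : θ.Provisos₁₁), θ.Admissible ∧ D = datumOfRecord₁₁ F N θ hP ∧ S = cr F θ hP g₀ os)
    (hrows : ∀ (F : T4Family) (θ : Stage11Params F N) (hP : θ.Provisos₁₁), θ.Admissible → ∀ (g₀ : ℕ → ℝ) (os : List (ULoop F)),
      ∃ (Nw : ℕ) (n : ℕ → ℕ) (shAs shBs : (Σ _ : ℕ, ℕ) → ℕ → ℝ → (cr F θ hP g₀ os).ι → ℝ) (x : ℕ → ℕ → ℝ) (p y : ℕ → ℝ),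
        AgeLedger (cr F θ hP g₀ os).l₀ (cr F θ hP g₀ os).T (cr F θ hP g₀ os).A Nw n shAs x ∧
        AgeLedger (cr F θ hP g₀ os).l₀ (cr F θ hP g₀ os).T (cr F θ hP g₀ os).B Nw n shBs x ∧
        (∀ K t, |t| ≤ (cr F θ hP g₀ os).l₀ → ∀ τ ∈ (cr F θ hP g₀ os).T K, 0 ≤ (cr F θ hP g₀ os).shA K t τ) ∧
        (∀ K t, |t| ≤ (cr F θ hP g₀ os).l₀ → ∀ τ ∈ (cr F θ hP g₀ os).T K, (cr F θ hP g₀ os).shA K t τ ≤ (cr F θ hP g₀ os).A K t τ) ∧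
        (∀ K t, |t| ≤ (cr F θ hP g₀ os).l₀ → ∀ τ ∈ (cr F θ hP g₀ os).T K,
          (cr F θ hP g₀ os).shA K t τ ≤ ∑ σ ∈ (range (Nw + 1)).sigma (fun a => range (n a)), shAs σ K t τ) ∧
        (∀ K t, |t| ≤ (cr F θ hP g₀ os).l₀ → ∀ τ ∈ (cr F θ hP g₀ os).T K, 0 ≤ (cr F θ hP g₀ os).shB K t τ) ∧
        (∀ K t, |t| ≤ (cr F θ hP g₀ os).l₀ → ∀ τ ∈ (cr F θ hP g₀ os).T K, (cr F θ hP g₀ os).shB K t τ ≤ (cr F θ hP g₀ os).B K t τ) ∧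
        (∀ K t, |t| ≤ (cr F θ hP g₀ os).l₀ → ∀ τ ∈ (cr F θ hP g₀ os).T K,
          (cr F θ hP g₀ os).shB K t τ ≤ ∑ σ ∈ (range (Nw + 1)).sigma (fun a => range (n a)), shBs σ K t τ) ∧
        LevelGain Nw x p y ∧
        (∀ K, ∑ a ∈ range (Nw + 1), (n a : ℝ) * (Real.exp (-p a) * y (K - a)) ≤ (cr F θ hP g₀ os).Wsh K) ∧
        Summable (cr F θ hP g₀ os).Wsh) :
    S_N21 SRec :=
  s_N21_of_agesReading SRec fun F D g₀ os S hS => by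
    obtain ⟨θ, hP, hθ, -, rfl⟩ := hkey F D g₀ os S hS
    exact hrows F θ hP hθ g₀ os

end Closers

/-! ## §3 Where the ₁₁ objects enter N21: (a) NE7c as the ₁₁ sentence under the E1∕E2 dictionary at `datumOfRecord₁₁ F N θ hP` -/

section Dictionary

variable {F : T4Family}

/-- **NE7c AS THE ₁₁ SENTENCE, run A.**  If a bundle `S` pinned at the Stage-11 datum of θ satisfies run A's dictionary E1 there (its class sums ARE the
dressed partition functions of the string after `S.K₀ + K` steps on `|t| ≤ S.l₀`, the `S_N27x` clause) and NE7c's `ShellWeightBound`, then at every cutoff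
and source THE SHELL PARTS CARRY AT MOST THE FRACTION `S.Wsh K` OF THE STRING'S DRESSED PARTITION FUNCTION OF RECORD:
`Σ_{τ ∈ S.T K} S.shA K t τ ≤ S.Wsh K · schemeZ ((datumOfRecord₁₁ F N θ hP).scheme g₀) os (S.K₀ + K) t` (a positive number at ₁₁:
`N20AtRecord11.schemeZ_pos_datumOfRecord₁₁`). [bookkeeping] -/
theorem shellWeight_le_schemeZ_datumOfRecord₁₁_left (θ : Stage11Params F N) (hP : θ.Provisos₁₁) (g₀ : ℕ → ℝ) (os : List (ULoop F))
    (S : SpineCarriers)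
    (hE1 : ∀ (K : ℕ) (t : ℝ), |t| ≤ S.l₀ →
      T4GenFunBounds.schemeZ ((datumOfRecord₁₁ F N θ hP).scheme g₀) os (S.K₀ + K) t = ∑ τ ∈ S.T K, S.A K t τ)
    (h21 : ShellWeightBound S.l₀ S.T S.A S.B S.shA S.shB S.Wsh) (K : ℕ) (t : ℝ) (ht : |t| ≤ S.l₀) :
    ∑ τ ∈ S.T K, S.shA K t τ ≤ S.Wsh K * T4GenFunBounds.schemeZ ((datumOfRecord₁₁ F N θ hP).scheme g₀) os (S.K₀ + K) t := by
  rw [hE1 K t ht]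
  exact h21.left K t ht

/-- **NE7c AS THE ₁₁ SENTENCE, run B** (dictionary E2: class sums = the dressed partition functions after `S.K₀ + K + 1` steps). [bookkeeping] -/
theorem shellWeight_le_schemeZ_datumOfRecord₁₁_right (θ : Stage11Params F N) (hP : θ.Provisos₁₁) (g₀ : ℕ → ℝ) (os : List (ULoop F))
    (S : SpineCarriers)
    (hE2 : ∀ (K : ℕ) (t : ℝ), |t| ≤ S.l₀ →
      T4GenFunBounds.schemeZ ((datumOfRecord₁₁ F N θ hP).scheme g₀) os (S.K₀ + K + 1) t = ∑ τ ∈ S.T K, S.B K t τ)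
    (h21 : ShellWeightBound S.l₀ S.T S.A S.B S.shA S.shB S.Wsh) (K : ℕ) (t : ℝ) (ht : |t| ≤ S.l₀) :
    ∑ τ ∈ S.T K, S.shB K t τ ≤ S.Wsh K * T4GenFunBounds.schemeZ ((datumOfRecord₁₁ F N θ hP).scheme g₀) os (S.K₀ + K + 1) t := by
  rw [hE2 K t ht]
  exact h21.right K t ht

/-- **THE SHELLS NEVER EXHAUST THE STRING's PARTITION FUNCTION from some cutoff on** (E1 at the ₁₁ datum + NE7c): since `Σ_K S.Wsh K < ∞`, eventually
`S.Wsh K < 1`, and then run A's shell part is STRICTLY below the dressed partition function of record on `|t| ≤ S.l₀` (positivity at ₁₁ by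
`N20AtRecord11.schemeZ_pos_datumOfRecord₁₁`) — the N21 half of the budget clause `W + Wsh < 1` the ₁₁ join derives in its tail. [bookkeeping] -/
theorem eventually_shellWeight_lt_schemeZ_datumOfRecord₁₁ (θ : Stage11Params F N) (hP : θ.Provisos₁₁) (g₀ : ℕ → ℝ) (os : List (ULoop F))
    (S : SpineCarriers)
    (hE1 : ∀ (K : ℕ) (t : ℝ), |t| ≤ S.l₀ →
      T4GenFunBounds.schemeZ ((datumOfRecord₁₁ F N θ hP).scheme g₀) os (S.K₀ + K) t = ∑ τ ∈ S.T K, S.A K t τ)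
    (h21 : ShellWeightBound S.l₀ S.T S.A S.B S.shA S.shB S.Wsh) :
    ∃ K₁ : ℕ, ∀ K, K₁ ≤ K → ∀ t : ℝ, |t| ≤ S.l₀ →
      ∑ τ ∈ S.T K, S.shA K t τ < T4GenFunBounds.schemeZ ((datumOfRecord₁₁ F N θ hP).scheme g₀) os (S.K₀ + K) t := by
  have hlim := h21.summable.tendsto_atTop_zero
  obtain ⟨K₁, hK₁⟩ := Filter.eventually_atTop.mp ((tendsto_order.mp hlim).2 1 one_pos)
  refine ⟨K₁, fun K hK t ht => ?_⟩
  have hZ := N20AtRecord11.schemeZ_pos_datumOfRecord₁₁ (N := N) θ hP g₀ os (S.K₀ + K) t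
  calc ∑ τ ∈ S.T K, S.shA K t τ
      ≤ S.Wsh K * T4GenFunBounds.schemeZ ((datumOfRecord₁₁ F N θ hP).scheme g₀) os (S.K₀ + K) t :=
        shellWeight_le_schemeZ_datumOfRecord₁₁_left θ hP g₀ os S hE1 h21 K t ht
    _ < 1 * T4GenFunBounds.schemeZ ((datumOfRecord₁₁ F N θ hP).scheme g₀) os (S.K₀ + K) t :=
        mul_lt_mul_of_pos_right (hK₁ K hK) hZ
    _ = _ := one_mul _

end Dictionary

/-! ## §4 Non-vacuity of the ₁₁-typed stub ⟺ the body of K0 at `N`; the consumer face at a Stage-11 record pair -/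

/-- **IF THE STAGE-11 RECORD CLASS IS EMPTY, `S_N21` AT ₁₁ IS FREE.**  If on no family an admissible Stage-11 parameter tuple satisfies its displayed provisos
(the NEGATION of K0's body at `N`), a spine-carrier predicate typed over ₁₁C pins no bundle at all, and `S_N21 SRec` holds with no estimate.  Conversely, under
K0's body a keyed predicate pins a bundle at a ₁₁ datum on every family — dag-n20-e's stub-agnostic `N20AtRecord11.exists_pinned_keyed₁₁_of_inhabited`
(cited, not restated).  Located vacuity: the ₁₁ knit is worth exactly as much as K0. [bookkeeping] -/
theorem s_N21_keyed₁₁_of_uninhabited (SRec : SpineRecordPred N)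
    (htyped : ∀ (F : T4Family) (D : Datum F N) (g₀ : ℕ → ℝ) (os : List (ULoop F)) (S : SpineCarriers), SRec F D g₀ os S →
      ∃ (θ : Stage11Params F N) (hP : θ.Provisos₁₁), θ.Admissible ∧ D = datumOfRecord₁₁ F N θ hP)
    (hempty : ∀ (F : T4Family) (θ : Stage11Params F N), θ.Admissible → ¬ θ.Provisos₁₁) :
    S_N21 SRec := by
  intro F D g₀ os S hS
  obtain ⟨θ, hP, hθ, -⟩ := htyped F D g₀ os S hS
  exact absurd hP (hempty F θ hθ)

section KeyedAtRecord

variable (cr : (F : T4Family) → (θ : Stage11Params F N) → θ.Provisos₁₁ → (ℕ → ℝ) → List (ULoop F) → SpineCarriers)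

/-- **THE CONSUMER FACE AT A STAGE-11 RECORD PAIR.**  At a predicate keyed at ₁₁ by `cr` with `S_N21 SRec`: every Stage-11 record pair `(D, w)` comes with an
admissible θ with provisos realising `D`, and for every `(g₀, os)` the bundle `cr F θ hP g₀ os` IS PINNED AT THE PAIR'S OWN DATUM and carries NE7c there —
the N21 conjunct the ₁₁ join of N27 (`YMDAG.UVSplit.SpineMatching_of` at `Rec := IsRecordOfRecord₁₁C F N`) consumes next to `S_N27x`, `S_N20`, `S_N19`.
[bookkeeping] -/
theorem shellWeightBound_keyed₁₁_of_isRecordOfRecord₁₁C (SRec : SpineRecordPred N)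
    (hkey : ∀ (F : T4Family) (D : Datum F N) (g₀ : ℕ → ℝ) (os : List (ULoop F)) (S : SpineCarriers), SRec F D g₀ os S ↔
      ∃ (θ : Stage11Params F N) (hP : θ.Provisos₁₁), θ.Admissible ∧ D = datumOfRecord₁₁ F N θ hP ∧ S = cr F θ hP g₀ os)
    (h : S_N21 SRec) {F : T4Family} {D : Datum F N} {w : DagBinding.WorldP} (hR : IsRecordOfRecord₁₁C F N D w) :
    ∃ (θ : Stage11Params F N) (hP : θ.Provisos₁₁), θ.Admissible ∧ D = datumOfRecord₁₁ F N θ hP ∧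
      ∀ (g₀ : ℕ → ℝ) (os : List (ULoop F)), SRec F D g₀ os (cr F θ hP g₀ os) ∧
        ShellWeightBound (cr F θ hP g₀ os).l₀ (cr F θ hP g₀ os).T (cr F θ hP g₀ os).A (cr F θ hP g₀ os).B (cr F θ hP g₀ os).shA
          (cr F θ hP g₀ os).shB (cr F θ hP g₀ os).Wsh := by
  obtain ⟨θ, hP, hθ, hD⟩ := Node00.exists_provisos_of_isRecordOfRecord₁₁C hR
  refine ⟨θ, hP, hθ, hD, fun g₀ os => ?_⟩
  have hS : SRec F D g₀ os (cr F θ hP g₀ os) := (hkey F D g₀ os _).mpr ⟨θ, hP, hθ, hD, rfl⟩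
  exact ⟨hS, h F D g₀ os _ hS⟩

/-! ## §5 The shadow: the same reading keyed to def-T's ₅C shadow datum gives the same `S_N21` -/

/-- **N21 IS INVARIANT UNDER RE-KEYING TO THE ₅C SHADOW.**  Key the SAME reading `cr` once at the Stage-11 datum `datumOfRecord₁₁ F N θ hP` (`SRec₁₁`) and
once at def-T's ₅C SHADOW datum `datumOfRecord₅ F N (shadow₅OfRecord₁₁ F N θ hP γ')` of the same θ at any interval letter `γ'` (`SRec₅`; `Record11` §8).
Then `S_N21 SRec₁₁ ↔ S_N21 SRec₅`: both pin the same SET of bundles (§1 `s_N21_of_image` twice) — along n27-a's shadow road the N21 conjunct needs no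
congruence lemma (twin of `N20AtRecord11.s_N20_keyed₁₁_iff_shadow₅`). [bookkeeping] -/
theorem s_N21_keyed₁₁_iff_shadow₅ (SRec₁₁ SRec₅ : SpineRecordPred N)
    (hkey₁₁ : ∀ (F : T4Family) (D : Datum F N) (g₀ : ℕ → ℝ) (os : List (ULoop F)) (S : SpineCarriers), SRec₁₁ F D g₀ os S ↔
      ∃ (θ : Stage11Params F N) (hP : θ.Provisos₁₁), θ.Admissible ∧ D = datumOfRecord₁₁ F N θ hP ∧ S = cr F θ hP g₀ os)
    (hkey₅ : ∀ (F : T4Family) (D : Datum F N) (g₀ : ℕ → ℝ) (os : List (ULoop F)) (S : SpineCarriers), SRec₅ F D g₀ os S ↔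
      ∃ (θ : Stage11Params F N) (hP : θ.Provisos₁₁) (γ' : ℝ), θ.Admissible ∧
        D = Node00.datumOfRecord₅ F N (Node00.shadow₅OfRecord₁₁ F N θ hP γ') ∧ S = cr F θ hP g₀ os) :
    S_N21 SRec₁₁ ↔ S_N21 SRec₅ := by
  constructor
  · refine fun h => s_N21_of_image (fun S ⟨F, D, g₀, os, hS⟩ => ?_) h
    obtain ⟨θ, hP, γ', hθ, -, rfl⟩ := (hkey₅ F D g₀ os S).mp hS
    exact ⟨F, _, g₀, os, (hkey₁₁ F _ g₀ os _).mpr ⟨θ, hP, hθ, rfl, rfl⟩⟩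
  · refine fun h => s_N21_of_image (fun S ⟨F, D, g₀, os, hS⟩ => ?_) h
    obtain ⟨θ, hP, hθ, -, rfl⟩ := (hkey₁₁ F D g₀ os S).mp hS
    exact ⟨F, _, g₀, os, (hkey₅ F _ g₀ os _).mpr ⟨θ, hP, 0, hθ, rfl, rfl⟩⟩

/-! ## §6 The A2 trap persists at ₁₁ — reading for the (T-SPINE) author -/

/-- **THE ZERO-SHELL READING IS FREE AT ₁₁ TOO.**  A predicate keyed at ₁₁ (one-sided key) by a reading `cr` whose bundles have ZERO shell parts
(`shA = shB = 0`), zero slot (`Wsh = 0`) and termwise nonnegative weights on the classes has `S_N21` with NO estimate — p419285's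
`N21AtSpineCarriers.s_N21_of_zeroShellReading` re-keyed over θ.  So neither the ₁₁ keying nor K0 protects the stub against this junk: the (T-SPINE) author
must pin `(cr …).shA ∕ .shB` ONCE as the parts of the terms on which the two runs' products of the record's slot indicators `Node00.chiOfRecord` DISAGREE
(companion module `BalabanUVNodesN21SlotTestAtRecord`), the SAME parts `S_N19`'s cores `A − shA`, `B − shB` exclude. [bookkeeping] -/
theorem s_N21_keyed₁₁_of_zeroShell (SRec : SpineRecordPred N)
    (hkey : ∀ (F : T4Family) (D : Datum F N) (g₀ : ℕ → ℝ) (os : List (ULoop F)) (S : SpineCarriers), SRec F D g₀ os S →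
      ∃ (θ : Stage11Params F N) (hP : θ.Provisos₁₁), θ.Admissible ∧ D = datumOfRecord₁₁ F N θ hP ∧ S = cr F θ hP g₀ os)
    (hzero : ∀ (F : T4Family) (θ : Stage11Params F N) (hP : θ.Provisos₁₁), θ.Admissible → ∀ (g₀ : ℕ → ℝ) (os : List (ULoop F)),
      (∀ K t τ, (cr F θ hP g₀ os).shA K t τ = 0) ∧ (∀ K t τ, (cr F θ hP g₀ os).shB K t τ = 0) ∧ (∀ K, (cr F θ hP g₀ os).Wsh K = 0) ∧
        (∀ K t, |t| ≤ (cr F θ hP g₀ os).l₀ → ∀ τ ∈ (cr F θ hP g₀ os).T K, 0 ≤ (cr F θ hP g₀ os).A K t τ) ∧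
        (∀ K t, |t| ≤ (cr F θ hP g₀ os).l₀ → ∀ τ ∈ (cr F θ hP g₀ os).T K, 0 ≤ (cr F θ hP g₀ os).B K t τ)) :
    S_N21 SRec :=
  s_N21_of_zeroShellReading SRec fun F D g₀ os S hS => by
    obtain ⟨θ, hP, hθ, -, rfl⟩ := hkey F D g₀ os S hS
    exact hzero F θ hP hθ g₀ os

end KeyedAtRecord

end Summit.QuantumFields.YangMills.Theorems.N21AtRecord11
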